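import Summits.Ventures.YMGap.RobustBall.ConcentrationTorus
import Summits.Ventures.YMGap.RobustBall.TorusEnergyVarianceCeilingBall
import Summits.Ventures.YMGap.RobustBall.BallClosure
import HarnessLib

/-!
# Venture YMGap, track ROBUST-BALL (Y2) — GAUSSIAN CONCENTRATION OF THE ENERGY DENSITY AT THE VOLUME SCALE, uniformly on the tier-1 torus
# ball inside the robust door

HONEST FRAMING. WHAT THIS IS: a venture file (cell `pub-ymgap`, track Y2 ROBUST-BALL, seat rb-p2, theorems only, 0 compute).  Finite-volume
(torus) LATTICE statements for the members `W` of rb-theory's tier-1 torus ball `ClusterDomainFR ε₀ ε₁ r`, `G = SU(N)`, INSIDE the robust torus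
door `RobustTorusDoor N d β ε₀ ε₁ r ρ` (`0 ≤ ρ < 1`; ds-2's currency, hypothesis-free on the certified cells): ds-3's McDiarmid inequality on the
torus (`ConcentrationTorus.torus_measureReal_abs_ge_le_of_robustTorusDoor`) left the lattice sums for EXTENSIVE observables to a follow-up; here
they are done for the Wilson energy density `S_W / L^d`.
* `isLipBound_torusPlaquette` / ★ `isLipBound_wilsonAction` — the Wilson action has the per-link `suFrobDist`-Lipschitz vector `8(d−1)√N`
  (transported plaquette cylinders, `≤ 2(d−1)` plaquettes through a link).
* `sum_pow_ceil_le` — the single-link influence sum `Σ_z ρ^{⌈‖z−y‖_T/r₁⌉₊} ≤ d · ((1+e^{−m/d})/(1−e^{−m/d}))^d`, `m = −log(max ρ ½)/r₁`, uniformly in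
  the volume (this seat's torus lattice sum `sum_exp_neg_mul_torusNorm_le`).
* `energy_varianceProxy_le` — McDiarmid's variance proxy of `S_W/L^d` is `≤ C_E · L^{−d}`, `C_E = d · (16 N d (d−1) Θ)²`.
* ★★ `energyDensity_concentration_of_robustTorusDoor` — for EVERY torus `L ≥ 3`, EVERY member `W ∈ ClusterDomainFR ε₀ ε₁ r` and every `a ≥ 0`:
  `μ_{Λ_L,β,W}{ |S_W/L^d − ⟨S_W⟩/L^d| ≥ a } ≤ 2 exp(−2 a² L^d / C_E)` — the energy density of every member self-averages with GAUSSIAN tails at the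
  volume scale, one rate constant for the whole ball (with this seat's floor `Var(S_W) ≥ m L^d`, the energy fluctuations are of order exactly `L^{d/2}`).
WHAT THIS IS NOT: inside the door only; not a large-deviation principle (upper tail bound only, Dobrushin constants); nothing about the continuum
limit or a Clay-sense mass gap.

References: C. McDiarmid (1989); C. Külske, CMP 239 (2003); the tree's `ConcentrationTorus.lean` (ds-3), `TorusEnergyVarianceCeilingBall.lean`.
Everything here is proved; no definition, no named fact. [folklore]
-/

noncomputable section

open MeasureTheory ProbabilityTheory Finset Function Filter Topology Real
open Literature.Probability.LatticeModels (Torus.proj)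
open Literature.Probability.LatticeModels.DobrushinMetric
open Literature.MathematicalPhysics.QuantumLattice hiding torusNorm
open Literature.MathematicalPhysics.QuantumFieldTheory hiding ZdEdge Site

namespace Summit.Ventures.YMGap.RobustBall

namespace EnergyVariance

variable {d L N : ℕ} [NeZero L]

/-! ### Lipschitz vectors of the torus plaquette observables and of the Wilson action -/

/-- The torus plaquette observable `Re tr U_q` has the transported Lipschitz vector of the `ℤ^d` plaquette at the integer lift of `q`. [folklore] -/
theorem isLipBound_torusPlaquette (q : Plaquette d L) [DecidableEq (Edge d L)] :
    IsLipBound suFrobDist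
      (fun U : GaugeConfig d L (SUN N) => ((fundamentalRep (Fin N)) (plaquetteHolonomy U q.1 q.2.1.1 q.2.1.2)).trace.re)
      (fun eb => ∑ x ∈ (plaquetteEdges ((fun i => ((q.1 i).val : ℤ), q.2) : ZdPlaquette d)).filter (fun x => torusEdge L x = eb),
        (if x ∈ plaquetteEdges ((fun i => ((q.1 i).val : ℤ), q.2) : ZdPlaquette d) then Real.sqrt N else 0)) := by
  rw [plaquetteObs_eq_toTorusObservable (fundamentalRep (Fin N)) q]
  exact isLipBound_toTorusObservable L suFrobDist_self
    (isCylinder_plaquetteObs (fundamentalRep (Fin N)) ((fun i => ((q.1 i).val : ℤ), q.2) : ZdPlaquette d))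
    (StateLipschitzRows.isLipBound_plaquetteObs ((fun i => ((q.1 i).val : ℤ), q.2) : ZdPlaquette d))

omit [NeZero L] in
/-- The transported Lipschitz vector of a plaquette is `≤ 4√N` at every link. [folklore] -/
theorem torusPlaquette_lipVector_le (p : ZdPlaquette d) (eb : Edge d L) [DecidableEq (Edge d L)] :
    ∑ x ∈ (plaquetteEdges p).filter (fun x => torusEdge L x = eb), (if x ∈ plaquetteEdges p then Real.sqrt N else 0) ≤
      4 * Real.sqrt N := by
  calc ∑ x ∈ (plaquetteEdges p).filter (fun x => torusEdge L x = eb), (if x ∈ plaquetteEdges p then Real.sqrt N else 0)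
      ≤ ∑ x ∈ plaquetteEdges p, (if x ∈ plaquetteEdges p then Real.sqrt N else 0) :=
        Finset.sum_le_sum_of_subset_of_nonneg (Finset.filter_subset _ _) fun x _ _ => by positivity
    _ = (plaquetteEdges p).card * Real.sqrt N := by
        rw [Finset.sum_ite_of_true (fun x hx => hx), Finset.sum_const, nsmul_eq_mul]
    _ ≤ 4 * Real.sqrt N := mul_le_mul_of_nonneg_right (by exact_mod_cast card_plaquetteEdges_le p) (Real.sqrt_nonneg _)

/-- ★ **The Wilson action is `8(d−1)√N`-Lipschitz in every link** (for `suFrobDist`): at most `2(d−1)` plaquettes pass through a link and each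
plaquette observable is `4√N`-Lipschitz there. [folklore] -/
theorem isLipBound_wilsonAction :
    IsLipBound suFrobDist (wilsonAction (d := d) (L := L) (G := SUN N) (fundamentalRep (Fin N)))
      (fun _ => 8 * (d - 1 : ℕ) * Real.sqrt N) := by
  classical
  set P : Plaquette d L → GaugeConfig d L (SUN N) → ℝ := fun q U =>
    ((fundamentalRep (Fin N)) (plaquetteHolonomy U q.1 q.2.1.1 q.2.1.2)).trace.re with hP
  refine ⟨fun _ => by positivity, fun y σ τ hστ => ?_⟩
  have hS : wilsonAction (d := d) (L := L) (G := SUN N) (fundamentalRep (Fin N)) σ -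
      wilsonAction (d := d) (L := L) (G := SUN N) (fundamentalRep (Fin N)) τ = ∑ q : Plaquette d L, (P q τ - P q σ) := by
    unfold wilsonAction
    rw [← Finset.sum_sub_distrib]
    refine Finset.sum_congr rfl fun q _ => ?_
    simp only [hP]
    ring
  -- plaquettes not through `y` do not see the change
  have hzero : ∀ q : Plaquette d L, y ∉ plaqEdgesT q → P q τ - P q σ = 0 := by
    intro q hq
    have h := dependsOn_plaquetteHolonomy (G := SUN N) q (fun e he => (hστ e (fun h' => hq (h' ▸ Finset.mem_coe.1 he))).symm)
    simp only [hP]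
    rw [show plaquetteHolonomy τ q.1 q.2.1.1 q.2.1.2 = plaquetteHolonomy σ q.1 q.2.1.1 q.2.1.2 from h, sub_self]
  -- plaquettes through `y`: `4√N`-Lipschitz
  have hle : ∀ q : Plaquette d L, |P q τ - P q σ| ≤ 4 * Real.sqrt N * suFrobDist (σ y) (τ y) := by
    intro q
    rw [abs_sub_comm]
    refine ((isLipBound_torusPlaquette q).le y σ τ hστ).trans ?_
    exact mul_le_mul_of_nonneg_right (torusPlaquette_lipVector_le _ y) (suFrobDist_nonneg _ _)
  rw [hS, ← Finset.sum_filter_add_sum_filter_not Finset.univ (fun q : Plaquette d L => y ∈ plaqEdgesT q),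
    Finset.sum_eq_zero (s := Finset.univ.filter fun q : Plaquette d L => ¬ y ∈ plaqEdgesT q)
      (fun q hq => hzero q (Finset.mem_filter.1 hq).2), add_zero]
  have hcard : ((Finset.univ.filter fun q : Plaquette d L => y ∈ plaqEdgesT q).card : ℝ) ≤ 2 * (d - 1 : ℕ) := by
    have h := card_plaqsThrough_le y
    have e : (Finset.univ.filter fun q : Plaquette d L => y ∈ plaqEdgesT q) = plaqsThrough y := by
      ext q; simp [plaqsThrough]
    rw [e]
    exact_mod_cast h
  calc |∑ q ∈ Finset.univ.filter (fun q : Plaquette d L => y ∈ plaqEdgesT q), (P q τ - P q σ)|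
      ≤ ∑ q ∈ Finset.univ.filter (fun q : Plaquette d L => y ∈ plaqEdgesT q), |P q τ - P q σ| := Finset.abs_sum_le_sum_abs _ _
    _ ≤ ∑ _q ∈ Finset.univ.filter (fun q : Plaquette d L => y ∈ plaqEdgesT q), 4 * Real.sqrt N * suFrobDist (σ y) (τ y) :=
        Finset.sum_le_sum fun q _ => hle q
    _ = ((Finset.univ.filter fun q : Plaquette d L => y ∈ plaqEdgesT q).card : ℝ) * (4 * Real.sqrt N * suFrobDist (σ y) (τ y)) := by
        rw [Finset.sum_const, nsmul_eq_mul]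
    _ ≤ (2 * (d - 1 : ℕ) : ℝ) * (4 * Real.sqrt N * suFrobDist (σ y) (τ y)) :=
        mul_le_mul_of_nonneg_right hcard (mul_nonneg (by positivity) (suFrobDist_nonneg _ _))
    _ = 8 * (d - 1 : ℕ) * Real.sqrt N * suFrobDist (σ y) (τ y) := by ring

/-- The energy density `S_W / L^d` is `8(d−1)√N / L^d`-Lipschitz in every link. [folklore] -/
theorem isLipBound_energyDensity :
    IsLipBound suFrobDist (fun U : GaugeConfig d L (SUN N) => ((L : ℝ) ^ d)⁻¹ * wilsonAction (fundamentalRep (Fin N)) U)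
      (fun _ => ((L : ℝ) ^ d)⁻¹ * (8 * (d - 1 : ℕ) * Real.sqrt N)) := by
  have h := isLipBound_smul (isLipBound_wilsonAction (d := d) (L := L) (N := N)) (((L : ℝ) ^ d)⁻¹)
  rw [abs_of_nonneg (by positivity)] at h
  exact h

/-! ### The variance proxy of the energy density -/

/-- **Single-link influence sum on the torus, uniform in the volume**: for `0 ≤ ρ < 1`, `1 ≤ r₁`, `d ≥ 1`, every link `y`,
`Σ_z ρ^{⌈‖z−y‖_T/r₁⌉₊} ≤ d · ((1+e^{−m/d})/(1−e^{−m/d}))^d` with `m = −log(max ρ ½)/r₁ > 0`. [folklore] -/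
theorem sum_pow_ceil_le (hd : 1 ≤ d) {ρ : ℝ} (hρ0 : 0 ≤ ρ) (hρ1 : ρ < 1) {r₁ : ℕ} (hr₁ : 1 ≤ r₁) (y : Edge d L) :
    ∑ z : Edge d L, ρ ^ ⌈(torusNorm (z.1 - y.1) : ℝ) / r₁⌉₊ ≤
      d * ((1 + Real.exp (-((-Real.log (max ρ (1 / 2)) / r₁) / d))) / (1 - Real.exp (-((-Real.log (max ρ (1 / 2)) / r₁) / d)))) ^ d := by
  set ρ' : ℝ := max ρ (1 / 2) with hρ'
  have hρ'0 : 0 < ρ' := lt_of_lt_of_le (by norm_num) (le_max_right _ _)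
  have hρ'1 : ρ' < 1 := max_lt hρ1 (by norm_num)
  have hr₁0 : (0 : ℝ) < r₁ := by exact_mod_cast hr₁
  set m : ℝ := -Real.log ρ' / r₁ with hm
  have hlog : Real.log ρ' < 0 := Real.log_neg hρ'0 hρ'1
  have hm0 : 0 < m := div_pos (by linarith) hr₁0
  -- `ρ^{⌈t⌉} ≤ ρ'^{⌈t⌉} ≤ e^{−m · ‖z − y‖}`
  have hterm : ∀ z : Edge d L, ρ ^ ⌈(torusNorm (z.1 - y.1) : ℝ) / r₁⌉₊ ≤ Real.exp (-m * (torusNorm (z.1 - y.1) : ℝ)) := by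
    intro z
    set t : ℝ := (torusNorm (z.1 - y.1) : ℝ) / r₁ with ht
    have ht0 : 0 ≤ t := by positivity
    have h1 : ρ ^ ⌈t⌉₊ ≤ ρ' ^ ⌈t⌉₊ := pow_le_pow_left₀ hρ0 (le_max_left _ _) _
    have h2 : ρ' ^ ⌈t⌉₊ = Real.exp (⌈t⌉₊ * Real.log ρ') := by
      rw [← Real.exp_log hρ'0, ← Real.exp_nat_mul, Real.exp_log hρ'0]
    have h3 : (⌈t⌉₊ : ℝ) * Real.log ρ' ≤ t * Real.log ρ' :=
      mul_le_mul_of_nonpos_right (Nat.le_ceil t) hlog.le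
    have h4 : t * Real.log ρ' = -m * (torusNorm (z.1 - y.1) : ℝ) := by
      rw [hm, ht]; field_simp
    calc ρ ^ ⌈t⌉₊ ≤ ρ' ^ ⌈t⌉₊ := h1
      _ = Real.exp (⌈t⌉₊ * Real.log ρ') := h2
      _ ≤ Real.exp (t * Real.log ρ') := Real.exp_le_exp.2 h3
      _ = Real.exp (-m * (torusNorm (z.1 - y.1) : ℝ)) := by rw [h4]
  calc ∑ z : Edge d L, ρ ^ ⌈(torusNorm (z.1 - y.1) : ℝ) / r₁⌉₊
      ≤ ∑ z : Edge d L, Real.exp (-m * (torusNorm (z.1 - y.1) : ℝ)) := Finset.sum_le_sum fun z _ => hterm z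
    _ = ∑ x : Literature.MathematicalPhysics.QuantumFieldTheory.Site d L, ∑ _i : Fin d, Real.exp (-m * (torusNorm (x - y.1) : ℝ)) := by
        rw [← Finset.univ_product_univ, Finset.sum_product]
    _ = d * ∑ x : Literature.MathematicalPhysics.QuantumFieldTheory.Site d L, Real.exp (-m * (torusNorm (x - y.1) : ℝ)) := by
        rw [Finset.mul_sum]
        refine Finset.sum_congr rfl fun x _ => ?_
        rw [Finset.sum_const, Finset.card_univ, Fintype.card_fin, nsmul_eq_mul]
    _ ≤ d * ((1 + Real.exp (-(m / d))) / (1 - Real.exp (-(m / d)))) ^ d :=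
        mul_le_mul_of_nonneg_left (sum_exp_neg_mul_torusNorm_le hd hm0 y.1) (Nat.cast_nonneg d)

/-- **The variance proxy of the energy density is `O(L^{−d})`**: with `κ = 8(d−1)√N` and `Θ` the torus sum bound,
`Σ_y (2√N Σ_z (κ/L^d) ρ^{⌈‖z−y‖_T/r₁⌉₊})² ≤ (d · (2√N κ d Θ)²) · L^{−d}`. [folklore] -/
theorem energy_varianceProxy_le (hd : 1 ≤ d) {ρ : ℝ} (hρ0 : 0 ≤ ρ) (hρ1 : ρ < 1) {r₁ : ℕ} (hr₁ : 1 ≤ r₁) :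
    ∑ y : Edge d L, (2 * Real.sqrt N * ∑ z ∈ (Finset.univ : Finset (Edge d L)),
        ((L : ℝ) ^ d)⁻¹ * (8 * (d - 1 : ℕ) * Real.sqrt N) * ρ ^ ⌈(torusNorm (z.1 - y.1) : ℝ) / r₁⌉₊) ^ 2 ≤
      (d * (2 * Real.sqrt N * (8 * (d - 1 : ℕ) * Real.sqrt N) * (d *
          ((1 + Real.exp (-((-Real.log (max ρ (1 / 2)) / r₁) / d))) / (1 - Real.exp (-((-Real.log (max ρ (1 / 2)) / r₁) / d)))) ^ d)) ^ 2) *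
        ((L : ℝ) ^ d)⁻¹ := by
  set Θ : ℝ := d * ((1 + Real.exp (-((-Real.log (max ρ (1 / 2)) / r₁) / d))) /
      (1 - Real.exp (-((-Real.log (max ρ (1 / 2)) / r₁) / d)))) ^ d with hΘ
  set κ : ℝ := 8 * (d - 1 : ℕ) * Real.sqrt N with hκ
  have hκ0 : 0 ≤ κ := by positivity
  have hL0 : (0 : ℝ) < (L : ℝ) ^ d := by
    have : (0 : ℝ) < L := by exact_mod_cast Nat.pos_of_ne_zero (NeZero.ne L)
    positivity
  have hinner : ∀ y : Edge d L, ∑ z ∈ (Finset.univ : Finset (Edge d L)), ((L : ℝ) ^ d)⁻¹ * κ * ρ ^ ⌈(torusNorm (z.1 - y.1) : ℝ) / r₁⌉₊ ≤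
      ((L : ℝ) ^ d)⁻¹ * κ * Θ := by
    intro y
    rw [← Finset.mul_sum]
    exact mul_le_mul_of_nonneg_left (sum_pow_ceil_le hd hρ0 hρ1 hr₁ y) (by positivity)
  have hinner0 : ∀ y : Edge d L, 0 ≤ ∑ z ∈ (Finset.univ : Finset (Edge d L)), ((L : ℝ) ^ d)⁻¹ * κ * ρ ^ ⌈(torusNorm (z.1 - y.1) : ℝ) / r₁⌉₊ :=
    fun y => Finset.sum_nonneg fun z _ => by positivity
  have hcardE : (Fintype.card (Edge d L) : ℝ) = (L : ℝ) ^ d * d := by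
    rw [Fintype.card_prod, Fintype.card_fun, ZMod.card, Fintype.card_fin]
    push_cast
    ring
  calc ∑ y : Edge d L, (2 * Real.sqrt N * ∑ z ∈ (Finset.univ : Finset (Edge d L)),
          ((L : ℝ) ^ d)⁻¹ * κ * ρ ^ ⌈(torusNorm (z.1 - y.1) : ℝ) / r₁⌉₊) ^ 2
      ≤ ∑ _y : Edge d L, (2 * Real.sqrt N * (((L : ℝ) ^ d)⁻¹ * κ * Θ)) ^ 2 := by
        refine Finset.sum_le_sum fun y _ => ?_
        have h1 := hinner y
        have h0 := hinner0 y
        have h2 : 0 ≤ 2 * Real.sqrt N * ∑ z ∈ (Finset.univ : Finset (Edge d L)),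
            ((L : ℝ) ^ d)⁻¹ * κ * ρ ^ ⌈(torusNorm (z.1 - y.1) : ℝ) / r₁⌉₊ := by positivity
        exact pow_le_pow_left₀ h2 (mul_le_mul_of_nonneg_left h1 (by positivity)) 2
    _ = (Fintype.card (Edge d L) : ℝ) * (2 * Real.sqrt N * (((L : ℝ) ^ d)⁻¹ * κ * Θ)) ^ 2 := by
        rw [Finset.sum_const, Finset.card_univ, nsmul_eq_mul]
    _ = (d * (2 * Real.sqrt N * κ * Θ) ^ 2) * ((L : ℝ) ^ d)⁻¹ := by
        rw [hcardE]
        field_simp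

/-! ### Gaussian concentration of the energy density -/

/-- ★★ **GAUSSIAN CONCENTRATION OF THE ENERGY DENSITY AT THE VOLUME SCALE, UNIFORMLY ON THE TIER-1 TORUS BALL INSIDE THE DOOR.**
`RobustTorusDoor N d β ε₀ ε₁ r ρ` with `0 ≤ ρ < 1`, `d ≥ 1`: for every torus `L ≥ 3`, every member `W ∈ ClusterDomainFR ε₀ ε₁ r` and every `a ≥ 0`,
`μ_{Λ_L,β,W}{ |S_W/L^d − ⟨S_W⟩_{Λ,β,W}/L^d| ≥ a } ≤ 2 exp(−2 a² L^d / C_E)`, `C_E = d (2√N · 8(d−1)√N · d Θ)²`, `Θ = ((1+e^{−m/d})/(1−e^{−m/d}))^d`,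
`m = −log(max ρ ½)/(r ⊔ 1)`. [folklore] -/
theorem energyDensity_concentration_of_robustTorusDoor (hd : 1 ≤ d) {β ε₀ ε₁ ρ : ℝ} {r : ℕ}
    (hdoor : RobustTorusDoor N d β ε₀ ε₁ r ρ) (hρ0 : 0 ≤ ρ) (hρ1 : ρ < 1) (hL : 3 ≤ L)
    {W : Perturbation d L N} (hW : W ∈ ClusterDomainFR ε₀ ε₁ r) {a : ℝ} (ha : 0 ≤ a) :
    (W.perturbedMeasure (fundamentalRep (Fin N)) β).real
        {U | a ≤ |((L : ℝ) ^ d)⁻¹ * wilsonAction (fundamentalRep (Fin N)) U -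
          ∫ U', ((L : ℝ) ^ d)⁻¹ * wilsonAction (fundamentalRep (Fin N)) U' ∂(W.perturbedMeasure (fundamentalRep (Fin N)) β)|} ≤
      2 * Real.exp (-2 * a ^ 2 * (L : ℝ) ^ d /
        (d * (2 * Real.sqrt N * (8 * (d - 1 : ℕ) * Real.sqrt N) * (d *
          ((1 + Real.exp (-((-Real.log (max ρ (1 / 2)) / ((max r 1 : ℕ) : ℝ)) / d))) /
            (1 - Real.exp (-((-Real.log (max ρ (1 / 2)) / ((max r 1 : ℕ) : ℝ)) / d)))) ^ d)) ^ 2)) := by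
  classical
  haveI : SecondCountableTopology (Matrix (Fin N) (Fin N) ℂ) :=
    inferInstanceAs (SecondCountableTopology (Fin N → Fin N → ℂ))
  haveI : SecondCountableTopology (SUN N) := Topology.IsEmbedding.subtypeVal.secondCountableTopology
  set CE : ℝ := d * (2 * Real.sqrt N * (8 * (d - 1 : ℕ) * Real.sqrt N) * (d *
      ((1 + Real.exp (-((-Real.log (max ρ (1 / 2)) / ((max r 1 : ℕ) : ℝ)) / d))) /
        (1 - Real.exp (-((-Real.log (max ρ (1 / 2)) / ((max r 1 : ℕ) : ℝ)) / d)))) ^ d)) ^ 2 with hCE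
  have hρc : Continuous (fundamentalRep (Fin N) : SUN N →* Matrix (Fin N) (Fin N) ℂ) := continuous_fundamentalRep (Fin N)
  have hL0 : (0 : ℝ) < (L : ℝ) ^ d := by
    have : (0 : ℝ) < L := by exact_mod_cast (show 0 < L by omega)
    positivity
  obtain ⟨B, hB⟩ := exists_abs_wilsonAction_le (d := d) (L := L) (fundamentalRep (Fin N) : SUN N →* Matrix (Fin N) (Fin N) ℂ) hρc
  -- McDiarmid on the torus with the energy density
  have hV := energy_varianceProxy_le (L := L) (N := N) hd hρ0 hρ1 (le_max_right r 1)
  have key := torus_measureReal_abs_ge_le_of_robustTorusDoor hdoor hρ0 hρ1.le hL hW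
    (f := fun U : GaugeConfig d L (SUN N) => ((L : ℝ) ^ d)⁻¹ * wilsonAction (fundamentalRep (Fin N)) U)
    ((measurable_wilsonAction _ hρc).const_mul _) (Δ := Finset.univ)
    (fun U V hUV => by
      have : U = V := funext fun e => hUV e (Finset.mem_coe.2 (Finset.mem_univ e))
      rw [this])
    (M := ((L : ℝ) ^ d)⁻¹ * B) (fun U => by
      rw [abs_mul, abs_of_nonneg (by positivity)]
      exact mul_le_mul_of_nonneg_left (hB U) (by positivity))
    (isLipBound_energyDensity (d := d) (L := L) (N := N)) hV ha
  refine key.trans (le_of_eq ?_)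
  rw [div_mul_eq_div_div, div_inv_eq_mul, div_mul_eq_mul_div]

end EnergyVariance

end Summit.Ventures.YMGap.RobustBall
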